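import Summits.BirchSwinnertonDyer.BirchSwinnertonDyer.Theses.PAdicOrderV2
import Summits.BirchSwinnertonDyer.BirchSwinnertonDyer.Theorems.PAdicOrderV2PAdicOrderComparisonR2StubConstantCoeff
import Summits.BirchSwinnertonDyer.BirchSwinnertonDyer.Theorems.PAdicOrderV2PAdicOrderComparisonR2StubTwoLeOrder
import Literature.NumberTheory.EllipticCurves.CyclotomicPAdicHeight
import Literature.NumberTheory.EllipticCurves.CanonicalPAdicHeightHolds
import Literature.NumberTheory.EllipticCurves.PAdicLFunctionK
import Literature.NumberTheory.EllipticCurves.BSDHeegnerPoints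

set_option linter.dupNamespace false

/-!
# Crux-strategist census file for crux #2 `PAdicOrderComparisonR2` (stmt-BirchSwinnertonDyer-0489)

Scratch evidence for `STRATEGY-CENSUS.md` (unit `cstrat-stmt-BirchSwinnertonDyer-0489-s1`).
Nothing here is route structure; it only TYPES the census entries over existing declarations.

* § Decomposition — the best typed split found: crux ⇔ `NoExcessZeros` ∧ `NoMissingZeros`
  (UB: `ord_T L_p ≤ r_an`; LB beyond parity: `3 ≤ r_an → r_an ≤ ord_T L_p`), glue
  `pAdicOrderComparisonR2_of_subs` PROVED from the landed legs S1 (interpolation, p97010) and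
  L2 (parity, p99469), and the converse `subs_of_pAdicOrderComparisonR2` (so the split is exact).
* § Strengthen — the candidate S⁺ statements as `Prop`s that elaborate:
  `SchneiderAtEveryOrdinaryPrime` (the height form of UB's p-adic part, typable since
  `exists_isCanonical_holds` landed) and `ComparisonOverHeegnerFields` (the `E/K` form, which
  unfolds to the ℚ-crux for `E` and for its twist because `padicLFunctionEK` is the product).
-/

namespace Summit.BirchSwinnertonDyer.BirchSwinnertonDyer.Cruxes.PAdicOrderComparisonR2.Strategist

open Summit.BirchSwinnertonDyer.BirchSwinnertonDyer.Theses.PAdicOrderV2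
open Summit.BirchSwinnertonDyer.BirchSwinnertonDyer.Theorems
open Literature.NumberTheory.EllipticCurves

/-! ## § Decomposition: UB / LB -/

/-- Sub₁ (UB, "no excess zeros"): at every good ordinary `p` and for the newform `f` of `E`,
`ord_{T=0} L_p(f, α_p, T) ≤ ord_{s=1} L(E,s)`. Open from analytic rank 1 (rank-1 Schneider,
non-CM); by Kato 18.4 it implies `corank Sel_{p^∞}(E/ℚ) ≤ r_an`, hence `rank E(ℚ) ≤ r_an(E)` for
every `E/ℚ` (landed necessity pattern `rank_add_shaCorank_le_analyticRank_of_comparison_of_katoDivisibility`). -/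
def NoExcessZeros : Prop :=
  ∀ (W : WeierstrassCurve ℚ) [W.IsElliptic] [W.IsGloballyMinimal] (p : ℕ) [Fact p.Prime],
    Literature.NumberTheory.EllipticCurves.IsOrdinaryAt W p →
    ∀ {N : ℕ} [NeZero N] (f : CuspForm (CongruenceSubgroup.Gamma0 N) 2),
      Literature.NumberTheory.EllipticCurves.ModularForms.IsNewformOf W f →
        (Literature.NumberTheory.EllipticCurves.padicLFunction f
          (Literature.NumberTheory.EllipticCurves.unitRoot W p : ℚ_[p])).order ≤ W.analyticRank

/-- Sub₂ (LB beyond parity, "no missing zeros"): `3 ≤ r_an → r_an ≤ ord_{T=0} L_p`. Ranks 0–2 are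
landed (interpolation S1, parity L2); rank 3 is known modulo the corank-one p-converse at big-image
`p ≥ 5`; OPEN from `r_an = 4` (a rank-two p-converse). A consequence of BSD ∧ Kato at odd `p`. -/
def NoMissingZeros : Prop :=
  ∀ (W : WeierstrassCurve ℚ) [W.IsElliptic] [W.IsGloballyMinimal] (p : ℕ) [Fact p.Prime],
    Literature.NumberTheory.EllipticCurves.IsOrdinaryAt W p →
    ∀ {N : ℕ} [NeZero N] (f : CuspForm (CongruenceSubgroup.Gamma0 N) 2),
      Literature.NumberTheory.EllipticCurves.ModularForms.IsNewformOf W f → 3 ≤ W.analyticRank →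
        (W.analyticRank : ℕ∞) ≤ (Literature.NumberTheory.EllipticCurves.padicLFunction f
          (Literature.NumberTheory.EllipticCurves.unitRoot W p : ℚ_[p])).order

/-- **Glue of the UB/LB split**: `NoExcessZeros → NoMissingZeros → PAdicOrderComparisonR2`,
from the landed legs S1 (`stub_constantCoeff_eq_zero_iff`, rank 1 lower bound) and L2
(`stub_two_le_order_of_analyticRank_eq_two`, rank 2 lower bound by parity). [folklore] -/
theorem pAdicOrderComparisonR2_of_subs (hUB : NoExcessZeros) (hLB : NoMissingZeros) :
    PAdicOrderComparisonR2 := by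
  intro W _ _ p _ hord N _ f hf
  apply le_antisymm (hUB W p hord f hf)
  rcases Nat.lt_or_ge W.analyticRank 1 with h0 | h1
  · have hr : W.analyticRank = 0 := by omega
    simp [hr]
  rcases Nat.lt_or_ge W.analyticRank 2 with h1' | h2
  · have hr : W.analyticRank = 1 := by omega
    have hc : PowerSeries.constantCoeff (Literature.NumberTheory.EllipticCurves.padicLFunction f
        (Literature.NumberTheory.EllipticCurves.unitRoot W p : ℚ_[p])) = 0 :=
      (stub_constantCoeff_eq_zero_iff W p hord f hf).mpr (by omega)
    rw [hr]
    refine PowerSeries.nat_le_order _ 1 fun i hi => ?_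
    have hi0 : i = 0 := by omega
    subst hi0
    simpa only [PowerSeries.coeff_zero_eq_constantCoeff] using hc
  rcases Nat.lt_or_ge W.analyticRank 3 with h2' | h3
  · have hr : W.analyticRank = 2 := by omega
    rw [hr, Nat.cast_ofNat]
    exact stub_two_le_order_of_analyticRank_eq_two W p hord f hf hr
  · exact hLB W p hord f hf h3

/-- The split is exact: the crux gives back both pieces. [folklore] -/
theorem subs_of_pAdicOrderComparisonR2 (h : PAdicOrderComparisonR2) :
    NoExcessZeros ∧ NoMissingZeros :=
  ⟨fun W _ _ p _ hord _ _ f hf => (h W p hord f hf).le,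
   fun W _ _ p _ hord _ _ f hf _ => (h W p hord f hf).ge⟩

/-! ## § Strengthen: the S⁺ candidates, typed -/

/-- S⁺_H (height form of UB's p-adic part): Schneider's conjecture for the CANONICAL cyclotomic
height at every good ordinary `p ≥ 5` — typable now that `exists_isCanonical_holds` is a tree
theorem (`W.cyclotomicPAdicHeight p` is canonical). Height-side twin of route item
`PAdicOrderSemisimpleR3` (stmt-0509) and of the parked stmt-0536. Open for every non-CM curve of
rank ≥ 1 (Mazur–Stein–Tate 2006, Conj. 1.1). -/
def SchneiderAtEveryOrdinaryPrime : Prop :=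
  ∀ (W : WeierstrassCurve ℚ) [W.IsElliptic] [W.IsGloballyMinimal] (p : ℕ) [Fact p.Prime],
    5 ≤ p → W.HasGoodReductionAtPrime p → ¬ (p : ℤ) ∣ W.frobeniusTrace p →
      WeierstrassCurve.SchneiderConjecture (W.cyclotomicPAdicHeight p)

/-- S⁺_K (the comparison over Heegner fields `K`): `ord_{T=0} L_p(E/K,T) = ord_{s=1} L(E/K,s)`.
In the tree `padicLFunctionEK W p K hf hg = L_p(f,α)·L_p(g,α')` by DEFINITION (factorised
normalisation), so this is the ℚ-crux for `W` and for its twist `W^{(d_K)}` at once — no extra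
rigidity; the genuinely two-variable (anticyclotomic) object is absent and its height is
degenerate in odd rank (barrier `AnticyclotomicHeightDegeneracy`). -/
def ComparisonOverHeegnerFields : Prop :=
  ∀ (W : WeierstrassCurve ℚ) [W.IsElliptic] [W.IsGloballyMinimal] (p : ℕ) [Fact p.Prime]
    (K : Type) [Field K] [NumberField K] {Nf Ng : ℕ} [NeZero Nf] [NeZero Ng]
    {f : CuspForm (CongruenceSubgroup.Gamma0 Nf) 2} {g : CuspForm (CongruenceSubgroup.Gamma0 Ng) 2}
    (hf : Literature.NumberTheory.EllipticCurves.ModularForms.IsNewformOf W f)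
    (hg : Literature.NumberTheory.EllipticCurves.ModularForms.IsNewformOf
      (W.quadraticTwist (NumberField.discr K : ℚ)) g),
    5 ≤ p → W.HasGoodReductionAtPrime p → ¬ (p : ℤ) ∣ W.frobeniusTrace p →
    IsImaginaryQuadratic K → ((Ideal.span {(p : ℤ)}).primesOver (NumberField.RingOfIntegers K)).ncard = 2 →
      (padicLFunctionEK W p K hf hg).order = analyticRankEK W K

end Summit.BirchSwinnertonDyer.BirchSwinnertonDyer.Cruxes.PAdicOrderComparisonR2.Strategist
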